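import Mathlib.FieldTheory.IsAlgClosed.Basic
import Mathlib.LinearAlgebra.Matrix.GeneralLinearGroup.Basic
import Mathlib.RingTheory.RootsOfUnity.AlgebraicallyClosed
import Mathlib.Topology.Instances.AddCircle.Defs
import Mathlib.Topology.Instances.Matrix
import Mathlib.Topology.Separation.Profinite
import Literature.NumberTheory.GaloisRepresentations.ProjectiveLifting
import HarnessLib

/-!
# Tate's lifting theorem for projective representations: the obstruction-theoretic layer

Sibling proof file of `ProjectiveLifting.lean` (named fact
`Patrikis2019_exists_lift_projective`).  The printed proof (S. Patrikis, *Variations on a theorem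
of Tate*, Mem. AMS 1238 (2019), Prop. 1.0.18 = B. Conrad, *Lifting global representations with
local properties*, Prop. 5.3, in the case `GL_n ↠ PGL_n` with isogeny complement `SL_n`) has two
ingredients:

* **[TOP]** (isogeny complement and obstruction class). A continuous
  `r : Γ → PGL_n(K) = GL_n(K) ⧸ centre` (profinite `Γ`, algebraically closed normed field `K`)
  has a continuous set-theoretic lift `s : Γ → GL_n(K)` with `det s = 1`; then
  `s(σ) s(τ) = z(σ,τ) s(στ)` for a continuous (hence locally constant) `μ_n(K)`-valued
  `2`-cocycle `z` ("obstruction classes `c_n ∈ H²(Γ_F, ℤ/n)`, as `Γ_F`-module the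
  `μ_n ⊂ S^∨[n]` is of course trivial"), and if `z` is the coboundary of a continuous
  `b : Γ → Kˣ` then `W := b⁻¹ s` is a continuous homomorphism lifting `r`.
* **[TATE]** Tate's theorem `H²(Γ_F, ℚ/ℤ) = 0` (Patrikis Thm. 1.0.16 = Serre, Durham survey,
  Thm. 4), which rests on global class field theory (local–global structure of the Brauer group
  and an extension lemma for Hecke characters) and kills the class of `z`.

This file proves **[TOP]** in full generality and records the resulting reduction: *if every
continuous `μ_n(K)`-valued `2`-cocycle on `Γ` is the coboundary of a continuous `Kˣ`-valued
cochain, then every continuous projective representation of `Γ` lifts*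
(`exists_continuousMonoidHom_lift_of_twoCocycle`), and its specialisation to `Γ = Γ_F`,
`K = ℚ̄_ℓ` (`Patrikis2019_exists_lift_of_twoCocycle`), which is part (i) of
`Patrikis2019_exists_lift_projective` conditional on exactly the vanishing statement that Tate's
theorem supplies.  **[TATE]** itself (global class field theory) is not in Mathlib or in this
tree, so the named fact is *not* discharged here.

## Contents

* `exists_continuous_of_forall_exists_nhds` — gluing of locally available continuous solutions on
  a compact totally disconnected space (finite clopen partitions).
* `exists_pow_eq_and_norm_sub_pow_le` — in an algebraically closed normed field every `a` has an
  `n`-th root `β` with `‖x - β‖ⁿ ≤ ‖xⁿ - a‖` (from `xⁿ - a = ∏ (x - β)`); `exists_rootSep`, the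
  separation of the `n`-th roots of unity `η ≠ 1` from `1`; `exists_continuousOn_pow_eq`, a
  branch of the `n`-th root continuous on a ball around `1`; continuous maps with values in
  `μ_n` are locally constant (`isLocallyConstant_of_pow_eq_one`).
* `exists_continuous_pow_eq` — a nowhere-vanishing continuous function on a compact totally
  disconnected space has a continuous `n`-th root.
* `exists_continuous_lift_quotient_center` — continuous set-theoretic lifts
  `Γ → GL_n(K)` of continuous maps `Γ → GL_n(K) ⧸ centre` (local section `[A] ↦ A / a_{ij}` on
  the open set `a_{ij} ≠ 0`, `QuotientGroup.isOpenMap_coe`).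
* `exists_normalized_lift_and_twoCocycle` (the normalised lift `s`, `det s = 1`, and its
  `μ_n`-valued obstruction cocycle), `exists_continuousMonoidHom_of_split` (the twist
  `W = b⁻¹ s`), `exists_continuousMonoidHom_lift_of_twoCocycle`,
  `Patrikis2019_exists_lift_of_twoCocycle` — the reduction of the lifting theorem to the
  vanishing of the obstruction class; `exists_continuousMonoidHom_lift_det_pow_eq_one_of_twoCocycle`
  — the same producing lifts with finite-order determinant (Remark 1.0.19 (2)).
* `twoCocycle_split_pow_eq_one_of_addCircle`, `twoCocycle_split_of_addCircle`,
  `Patrikis2019_exists_lift_of_H2_addCircle`,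
  `Patrikis2019_exists_lift_det_pow_eq_one_of_H2_addCircle` — the same with the hypothesis in
  the printed form "`H²(Γ, ℚ/ℤ) = 0`" (locally constant cochains with values in
  `ℚ/ℤ = AddCircle (1 : ℚ)`), via discrete logarithms and bounded denominators
  ("`lim→ H²(Γ_F, ℤ/n) = H²(Γ_F, ℚ/ℤ)`"), including the finite-order-determinant refinement.

## References

* [Patrikis2019] S. Patrikis, *Variations on a theorem of Tate*, Mem. Amer. Math. Soc. 258
  (2019), no. 1238, §1 "Review of lifting results", Thm. 1.0.16 and Prop. 1.0.18 (arXiv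
  numbering; = §2.1 of the memoir).
* B. Conrad, *Lifting global representations with local properties*, preprint (2011), Prop. 5.3.
* J.-P. Serre, *Modular forms of weight one and Galois representations*, in: Algebraic Number
  Fields (Durham 1975), Academic Press 1977, §6, Thm. 4 and its corollary.
-/

noncomputable section

open scoped NumberField
open Filter Topology Polynomial Matrix

namespace Literature.NumberTheory.GaloisRepresentations

/-! ### Gluing locally available continuous solutions on a profinite space -/

section Gluing

variable {X Y : Type*} [TopologicalSpace X] [CompactSpace X] [T2Space X]
  [TotallyDisconnectedSpace X] [TopologicalSpace Y]

/-- **Gluing on a compact totally disconnected space.** If around every point of a compact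
Hausdorff totally disconnected space `X` there is an open set carrying a continuous function `f`
with `P y (f y)` for all `y` in it, then there is a *globally* continuous `g` with `P x (g x)`
everywhere: refine the open cover by clopen sets (`compact_exists_isClopen_in_isOpen`), extract a
finite subcover and patch along the resulting finite clopen partition.  This is the standard
device by which continuous cochains of profinite groups are manipulated "as if `Γ` were finite".
[folklore] -/
theorem exists_continuous_of_forall_exists_nhds (P : X → Y → Prop)
    (h : ∀ x : X, ∃ U : Set X, IsOpen U ∧ x ∈ U ∧
      ∃ f : X → Y, ContinuousOn f U ∧ ∀ y ∈ U, P y (f y)) :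
    ∃ g : X → Y, Continuous g ∧ ∀ x, P x (g x) := by
  classical
  have hc : ∀ x : X, ∃ C : Set X, IsClopen C ∧ x ∈ C ∧
      ∃ f : X → Y, ContinuousOn f C ∧ ∀ y ∈ C, P y (f y) := by
    intro x
    obtain ⟨U, hU, hxU, f, hf, hP⟩ := h x
    obtain ⟨C, hC, hxC, hCU⟩ := compact_exists_isClopen_in_isOpen hU hxU
    exact ⟨C, hC, hxC, f, hf.mono hCU, fun y hy => hP y (hCU hy)⟩
  choose C hC hxC f hf hP using hc
  obtain ⟨t, ht⟩ := isCompact_univ.elim_finite_subcover C (fun x => (hC x).isOpen)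
    (fun x _ => Set.mem_iUnion.2 ⟨x, hxC x⟩)
  suffices H : ∀ s : Finset X, ∃ g : X → Y,
      ContinuousOn g (⋃ x ∈ s, C x) ∧ ∀ y ∈ ⋃ x ∈ s, C x, P y (g y) by
    obtain ⟨g, hg, hgP⟩ := H t
    have huniv : (⋃ x ∈ t, C x) = Set.univ := Set.eq_univ_of_univ_subset ht
    rw [huniv] at hg hgP
    exact ⟨g, continuousOn_univ.1 hg, fun x => hgP x (Set.mem_univ x)⟩
  intro s
  induction s using Finset.induction_on with
  | empty =>
    refine ⟨fun x => f x x, ?_, ?_⟩ <;> simp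
  | insert a s _ ih =>
    obtain ⟨g, hg, hgP⟩ := ih
    refine ⟨(C a).piecewise (f a) g, ?_, ?_⟩
    · rw [Finset.set_biUnion_insert]
      refine ContinuousOn.piecewise ?_ ?_ ?_
      · intro y hy
        rw [(hC a).frontier_eq] at hy
        exact absurd hy.2 (Set.notMem_empty _)
      · rw [(hC a).isClosed.closure_eq]
        exact (hf a).mono Set.inter_subset_right
      · rw [(hC a).compl.isClosed.closure_eq]
        refine hg.mono ?_
        rintro y ⟨hy | hy, hya⟩
        · exact absurd hy hya
        · exact hy
    · intro y hy
      by_cases hya : y ∈ C a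
      · rw [Set.piecewise_eq_of_mem _ _ _ hya]
        exact hP a y hya
      · rw [Set.piecewise_eq_of_notMem _ _ _ hya]
        rw [Finset.set_biUnion_insert] at hy
        exact hgP y (hy.resolve_left hya)

end Gluing

/-! ### `n`-th roots in an algebraically closed normed field -/

section Roots

variable {K : Type*} [NormedField K]

/-- A product over a multiset of reals each at least `a ≥ 0` is at least `a ^ card`.
[folklore] -/
private theorem pow_card_le_multiset_prod {m : Multiset ℝ} {a : ℝ} (ha : 0 ≤ a)
    (h : ∀ x ∈ m, a ≤ x) : a ^ Multiset.card m ≤ m.prod := by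
  induction m using Multiset.induction_on with
  | empty => simp
  | cons x m ih =>
    rw [Multiset.card_cons, pow_succ', Multiset.prod_cons]
    have hx : a ≤ x := h x (Multiset.mem_cons_self x m)
    have ih' := ih fun y hy => h y (Multiset.mem_cons_of_mem hy)
    exact mul_le_mul hx ih' (pow_nonneg ha _) (ha.trans hx)

/-- The norm of a multiset product in a normed field. [folklore] -/
private theorem norm_multiset_map_prod {ι : Type*} (m : Multiset ι) (g : ι → K) :
    ‖(m.map g).prod‖ = (m.map fun i => ‖g i‖).prod := by
  have := map_multiset_prod (normHom : K →*₀ ℝ) (m.map g)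
  simpa [Multiset.map_map, Function.comp_def] using this

/-- Roots of unity have norm one. [folklore] -/
theorem norm_eq_one_of_pow_eq_one' {n : ℕ} (hn : 0 < n) {η : K} (hη : η ^ n = 1) : ‖η‖ = 1 := by
  have h : ‖η‖ ^ n = 1 := by rw [← norm_pow, hη, norm_one]
  exact (pow_eq_one_iff_of_nonneg (norm_nonneg η) hn.ne').1 h

/-- **Separation of the `n`-th roots of unity.** There is `m > 0` (`m ≤ 2`) with
`m ≤ ‖1 - η‖` for every `n`-th root of unity `η ≠ 1` of the normed field `K` (there are finitely
many). [folklore] -/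
theorem exists_rootSep {n : ℕ} (hn : 0 < n) :
    ∃ m : ℝ, 0 < m ∧ m ≤ 2 ∧ ∀ η : K, η ^ n = 1 → η ≠ 1 → m ≤ ‖1 - η‖ := by
  classical
  by_cases h : (((nthRoots n (1 : K)).toFinset).erase 1).Nonempty
  · refine ⟨(((nthRoots n (1 : K)).toFinset).erase 1).inf' h (fun η => ‖1 - η‖), ?_, ?_, ?_⟩
    · rw [Finset.lt_inf'_iff]
      intro η hη
      rw [Finset.mem_erase] at hη
      exact norm_pos_iff.2 (sub_ne_zero.2 (Ne.symm hη.1))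
    · obtain ⟨η, hη⟩ := id h
      refine (Finset.inf'_le _ hη).trans ?_
      rw [Finset.mem_erase, Multiset.mem_toFinset, mem_nthRoots hn] at hη
      calc ‖1 - η‖ ≤ ‖(1 : K)‖ + ‖η‖ := norm_sub_le _ _
        _ = 2 := by rw [norm_one, norm_eq_one_of_pow_eq_one' hn hη.2]; norm_num
    · intro η hη hη1
      have hmem : η ∈ ((nthRoots n (1 : K)).toFinset).erase 1 := by
        rw [Finset.mem_erase, Multiset.mem_toFinset, mem_nthRoots hn]
        exact ⟨hη1, hη⟩
      exact Finset.inf'_le _ hmem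
  · refine ⟨1, one_pos, by norm_num, fun η hη hη1 => ?_⟩
    have hmem : η ∈ ((nthRoots n (1 : K)).toFinset).erase 1 := by
      rw [Finset.mem_erase, Multiset.mem_toFinset, mem_nthRoots hn]
      exact ⟨hη1, hη⟩
    exact absurd ⟨η, hmem⟩ h

/-- **Distinct `n`-th roots of the same element are far apart**: if `m` separates the `n`-th
roots of unity from `1`, `yⁿ = y'ⁿ`, `y ≠ y'` and `y ≠ 0`, then `‖y - y'‖ ≥ m · ‖y‖`
(`y' = η y` for a root of unity `η ≠ 1`). [folklore] -/
theorem mul_norm_le_norm_sub_of_pow_eq {n : ℕ} {m : ℝ}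
    (hm : ∀ η : K, η ^ n = 1 → η ≠ 1 → m ≤ ‖1 - η‖) {y y' : K} (hy : y ^ n = y' ^ n)
    (hne : y ≠ y') (hy0 : y ≠ 0) : m * ‖y‖ ≤ ‖y - y'‖ := by
  have hη : (y' / y) ^ n = 1 := by
    rw [div_pow, ← hy, div_self (pow_ne_zero n hy0)]
  have hη1 : y' / y ≠ 1 := by
    intro h
    rw [div_eq_one_iff_eq hy0] at h
    exact hne h.symm
  have hfac : y - y' = y * (1 - y' / y) := by
    rw [mul_sub, mul_one, mul_div_cancel₀ _ hy0]
  rw [hfac, norm_mul, mul_comm ‖y‖]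
  exact mul_le_mul_of_nonneg_right (hm _ hη hη1) (norm_nonneg y)

/-- **Continuous maps with values in `μ_n` are locally constant** (the `n`-th roots of unity form
a discrete subset of `K`). [folklore] -/
theorem isLocallyConstant_of_pow_eq_one {X : Type*} [TopologicalSpace X] {n : ℕ} (hn : 0 < n)
    {f : X → K} (hf : Continuous f) (hfn : ∀ x, f x ^ n = 1) : IsLocallyConstant f := by
  obtain ⟨m, hm0, -, hm⟩ := exists_rootSep (K := K) hn
  rw [IsLocallyConstant.iff_eventually_eq]
  intro x
  have hopen : IsOpen {y | ‖f x - f y‖ < m} :=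
    isOpen_lt (continuous_const.sub hf).norm continuous_const
  have hx : x ∈ {y | ‖f x - f y‖ < m} := by
    simp only [Set.mem_setOf_eq, sub_self, norm_zero]
    exact hm0
  filter_upwards [hopen.mem_nhds hx] with y hy
  by_contra hne
  have hfx0 : f x ≠ 0 := by
    intro h0
    have := hfn x
    rw [h0, zero_pow hn.ne'] at this
    exact zero_ne_one this
  have h1 : ‖f x‖ = 1 := norm_eq_one_of_pow_eq_one' hn (hfn x)
  have := mul_norm_le_norm_sub_of_pow_eq hm ((hfn x).trans (hfn y).symm) (Ne.symm hne) hfx0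
  rw [h1, mul_one] at this
  exact absurd hy (not_lt.2 this)

variable [IsAlgClosed K]

/-- **Roots depend continuously on the constant coefficient.** In an algebraically closed normed
field, for every `x` and `a` there is an `n`-th root `β` of `a` with `‖x - β‖ⁿ ≤ ‖xⁿ - a‖`
(`n ≥ 1`): indeed `xⁿ - a = ∏_β (x - β)` over the `n` roots `β` of `a` counted with
multiplicity, so the smallest factor has norm at most `‖xⁿ - a‖^{1/n}`. [folklore] -/
theorem exists_pow_eq_and_norm_sub_pow_le {n : ℕ} (hn : 0 < n) (x a : K) :
    ∃ β : K, β ^ n = a ∧ ‖x - β‖ ^ n ≤ ‖x ^ n - a‖ := by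
  classical
  have hsplit : (X ^ n - C a : K[X]).Splits := IsAlgClosed.splits _
  have hmonic : (X ^ n - C a : K[X]).Monic := monic_X_pow_sub_C a hn.ne'
  have hcard : Multiset.card (nthRoots n a) = n := by
    rw [nthRoots, IsAlgClosed.card_roots_eq_natDegree, natDegree_X_pow_sub_C]
  have heval : x ^ n - a = ((nthRoots n a).map (x - ·)).prod := by
    have := hsplit.eval_eq_prod_roots_of_monic hmonic x
    simpa [nthRoots, eval_sub, eval_pow, eval_X, eval_C] using this
  have hne : (nthRoots n a).toFinset.Nonempty := by
    rw [Multiset.toFinset_nonempty, ← Multiset.card_pos, hcard]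
    exact hn
  obtain ⟨β, hβ, hmin⟩ := (nthRoots n a).toFinset.exists_min_image (fun β => ‖x - β‖) hne
  rw [Multiset.mem_toFinset, mem_nthRoots hn] at hβ
  refine ⟨β, hβ, ?_⟩
  rw [heval, norm_multiset_map_prod]
  have hc : Multiset.card ((nthRoots n a).map fun β' => ‖x - β'‖) = n := by
    rw [Multiset.card_map, hcard]
  calc ‖x - β‖ ^ n = ‖x - β‖ ^ Multiset.card ((nthRoots n a).map fun β' => ‖x - β'‖) := by
        rw [hc]
    _ ≤ ((nthRoots n a).map fun β' => ‖x - β'‖).prod := by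
        refine pow_card_le_multiset_prod (norm_nonneg (x - β)) ?_
        intro t ht
        rw [Multiset.mem_map] at ht
        obtain ⟨β', hβ', rfl⟩ := ht
        exact hmin β' (Multiset.mem_toFinset.2 hβ')

/-- Every element of an algebraically closed normed field has an `n`-th root nearest to `1`
(`n ≥ 1`). [folklore] -/
theorem exists_pow_eq_forall_norm_sub_one_le {n : ℕ} (hn : 0 < n) (x : K) :
    ∃ r : K, r ^ n = x ∧ ∀ y : K, y ^ n = x → ‖r - 1‖ ≤ ‖y - 1‖ := by
  classical
  have hne : ((nthRoots n x).toFinset).Nonempty := by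
    obtain ⟨z, hz⟩ := IsAlgClosed.exists_pow_nat_eq x hn
    exact ⟨z, by rw [Multiset.mem_toFinset, mem_nthRoots hn]; exact hz⟩
  obtain ⟨r, hr, hmin⟩ := ((nthRoots n x).toFinset).exists_min_image (fun y => ‖y - 1‖) hne
  rw [Multiset.mem_toFinset, mem_nthRoots hn] at hr
  exact ⟨r, hr, fun y hy => hmin y (by rw [Multiset.mem_toFinset, mem_nthRoots hn]; exact hy)⟩

/-- **The branch of the `n`-th root near `1` is continuous.** In an algebraically closed normed
field there are `ε > 0` and a choice `ρ` of `n`-th roots (`ρ(x)ⁿ = x` for all `x`) which is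
continuous on the ball `‖x - 1‖ < ε`: take for `ρ x` a root nearest to `1` and
`ε = (m/4)ⁿ` with `m` the separation constant of `exists_rootSep`; on that ball the root within
`m/4` of `1` is unique, and roots move by at most `‖x - x'‖^{1/n}`
(`exists_pow_eq_and_norm_sub_pow_le`). [folklore] -/
theorem exists_continuousOn_pow_eq {n : ℕ} (hn : 0 < n) :
    ∃ (ε : ℝ) (ρ : K → K), 0 < ε ∧ (∀ x, ρ x ^ n = x) ∧ ContinuousOn ρ {x | ‖x - 1‖ < ε} := by
  obtain ⟨m, hm0, hm2, hm⟩ := exists_rootSep (K := K) hn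
  choose ρ hρn hρmin using exists_pow_eq_forall_norm_sub_one_le (K := K) hn
  set δ := m / 4 with hδ
  have hδpos : 0 < δ := by rw [hδ]; linarith
  have hδle : δ ≤ 1 / 2 := by rw [hδ]; linarith
  -- the chosen root is within `‖x - 1‖^{1/n}` of `1`
  have h1 : ∀ x, ‖ρ x - 1‖ ^ n ≤ ‖x - 1‖ := by
    intro x
    obtain ⟨β, hβ, hle⟩ := exists_pow_eq_and_norm_sub_pow_le hn (1 : K) x
    rw [one_pow, norm_sub_rev (1 : K) β] at hle
    rw [norm_sub_rev x 1]
    exact le_trans (pow_le_pow_left₀ (norm_nonneg _) (hρmin x β hβ) n) hle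
  -- uniqueness of the root near `1` on the ball
  have h2 : ∀ x y, ‖x - 1‖ < δ ^ n → y ^ n = x → ‖y - 1‖ < δ → y = ρ x := by
    intro x y hx hy hy1
    have hρ1 : ‖ρ x - 1‖ < δ := lt_of_pow_lt_pow_left₀ n hδpos.le ((h1 x).trans_lt hx)
    by_contra hne
    have hρnorm : 1 - δ < ‖ρ x‖ := by
      have : ‖(1 : K)‖ - ‖ρ x - 1‖ ≤ ‖ρ x‖ := by
        have := norm_sub_norm_le (1 : K) (1 - ρ x)
        rw [sub_sub_cancel, norm_sub_rev] at this
        exact this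
      rw [norm_one] at this
      linarith
    have hρ0 : ρ x ≠ 0 := by
      intro h0; rw [h0, norm_zero] at hρnorm; linarith
    have hsep := mul_norm_le_norm_sub_of_pow_eq hm ((hρn x).trans hy.symm) (Ne.symm hne) hρ0
    have hlow : m * (1 - δ) ≤ m * ‖ρ x‖ := mul_le_mul_of_nonneg_left hρnorm.le hm0.le
    have hup : ‖ρ x - y‖ < δ + δ :=
      calc ‖ρ x - y‖ = ‖(ρ x - 1) - (y - 1)‖ := by rw [sub_sub_sub_cancel_right]
        _ ≤ ‖ρ x - 1‖ + ‖y - 1‖ := norm_sub_le _ _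
        _ < δ + δ := add_lt_add hρ1 hy1
    have h4 : m = 4 * δ := by rw [hδ]; ring
    rw [h4] at hlow hsep
    nlinarith [hsep, hlow, hup, hδpos, hδle]
  refine ⟨δ ^ n, ρ, pow_pos hδpos n, hρn, ?_⟩
  rw [Metric.continuousOn_iff]
  intro x₀ hx₀ ε hε
  have hy₀1 : ‖ρ x₀ - 1‖ < δ := lt_of_pow_lt_pow_left₀ n hδpos.le ((h1 x₀).trans_lt hx₀)
  set t := min ε (δ - ‖ρ x₀ - 1‖) with ht
  have htpos : 0 < t := lt_min hε (by linarith)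
  refine ⟨t ^ n, pow_pos htpos n, fun x hx hdist => ?_⟩
  rw [dist_eq_norm] at hdist ⊢
  obtain ⟨β, hβ, hle⟩ := exists_pow_eq_and_norm_sub_pow_le hn (ρ x₀) x
  rw [hρn x₀, norm_sub_rev x₀ x] at hle
  have hβy : ‖ρ x₀ - β‖ < t := lt_of_pow_lt_pow_left₀ n htpos.le (hle.trans_lt hdist)
  have hβ1 : ‖β - 1‖ < δ := by
    have htri : ‖β - 1‖ ≤ ‖β - ρ x₀‖ + ‖ρ x₀ - 1‖ :=
      calc ‖β - 1‖ = ‖(β - ρ x₀) + (ρ x₀ - 1)‖ := by rw [sub_add_sub_cancel]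
        _ ≤ ‖β - ρ x₀‖ + ‖ρ x₀ - 1‖ := norm_add_le _ _
    have h1' : ‖β - ρ x₀‖ < t := by rw [norm_sub_rev]; exact hβy
    have h2' : t ≤ δ - ‖ρ x₀ - 1‖ := min_le_right _ _
    linarith
  have hβeq : β = ρ x := h2 x β hx hβ hβ1
  rw [← hβeq, norm_sub_rev]
  exact hβy.trans_le (min_le_left _ _)

end Roots

/-! ### Continuous `n`-th roots of nowhere-vanishing functions on profinite spaces -/

section ContinuousRoot

variable {K : Type*} [NormedField K] [IsAlgClosed K]
variable {X : Type*} [TopologicalSpace X] [CompactSpace X] [T2Space X] [TotallyDisconnectedSpace X]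

/-- **Continuous `n`-th roots on a profinite space.** A nowhere-vanishing continuous function
`d` on a compact Hausdorff totally disconnected space with values in an algebraically closed normed
field has a continuous `n`-th root (`n ≥ 1`): locally `d = d(x₀) · q` with `q` close to `1`, and
`α · ρ(q)` (`αⁿ = d(x₀)`, `ρ` the continuous branch of `exists_continuousOn_pow_eq`) is a
continuous root there; glue by `exists_continuous_of_forall_exists_nhds`.  (On a connected base
this fails already for `z ↦ z` on the unit circle; total disconnectedness is what makes the
obstruction classes of projective representations *locally constant*.) [folklore] -/
theorem exists_continuous_pow_eq {n : ℕ} (hn : 0 < n) {d : X → K} (hd : Continuous d)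
    (hd0 : ∀ x, d x ≠ 0) : ∃ e : X → K, Continuous e ∧ ∀ x, e x ^ n = d x := by
  obtain ⟨ε, ρ, hε, hρn, hρc⟩ := exists_continuousOn_pow_eq (K := K) hn
  refine exists_continuous_of_forall_exists_nhds (fun x y => y ^ n = d x) fun x₀ => ?_
  obtain ⟨α, hα⟩ := IsAlgClosed.exists_pow_nat_eq (d x₀) hn
  have hBo : IsOpen {x : K | ‖x - 1‖ < ε} :=
    isOpen_lt (continuous_id.sub continuous_const).norm continuous_const
  have hq : Continuous fun x => d x / d x₀ := hd.div_const _
  refine ⟨(fun x => d x / d x₀) ⁻¹' {x : K | ‖x - 1‖ < ε}, hBo.preimage hq, ?_,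
    fun x => α * ρ (d x / d x₀), ?_, ?_⟩
  · show ‖d x₀ / d x₀ - 1‖ < ε
    rw [div_self (hd0 x₀), sub_self, norm_zero]
    exact hε
  · exact continuousOn_const.mul (hρc.comp hq.continuousOn fun x hx => hx)
  · intro x _
    show (α * ρ (d x / d x₀)) ^ n = d x
    rw [mul_pow, hα, hρn, mul_div_cancel₀ _ (hd0 x₀)]

end ContinuousRoot

/-! ### Continuous set-theoretic lifts through `GL_n(K) → GL_n(K) ⧸ centre` -/

section Lift

variable {K : Type*} [NormedField K] {n : ℕ}

/-- Continuity of a `Units`-valued map on a set from continuity of its value and of the value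
of its inverse (the topology of `Mˣ` is induced by `M × Mᵐᵒᵖ`). [folklore] -/
private theorem continuousOn_units {M Y : Type*} [Monoid M] [TopologicalSpace M]
    [TopologicalSpace Y] {f : Y → Mˣ} {s : Set Y} (h1 : ContinuousOn (fun x => (f x : M)) s)
    (h2 : ContinuousOn (fun x => (((f x)⁻¹ : Mˣ) : M)) s) : ContinuousOn f s := by
  rw [Units.isInducing_embedProduct.continuousOn_iff]
  exact (h1.prodMk (MulOpposite.continuous_op.comp_continuousOn h2)).congr fun x _ => rfl

/-- Continuity of a `Units`-valued map from continuity of its value and of the value of its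
inverse. [folklore] -/
private theorem continuous_units {M Y : Type*} [Monoid M] [TopologicalSpace M]
    [TopologicalSpace Y] {f : Y → Mˣ} (h1 : Continuous fun x => (f x : M))
    (h2 : Continuous fun x => (((f x)⁻¹ : Mˣ) : M)) : Continuous f :=
  Units.continuous_iff.2 ⟨h1, h2⟩

/-- **Continuity on the image of an open map.** If `π` is an open map, `V` is open, and
`ω ∘ π` agrees on `V` with a function continuous on `V`, then `ω` is continuous on `π '' V`
(used for local sections of `GL_n(K) → GL_n(K) ⧸ centre`, an open quotient map).
[folklore] -/
private theorem continuousOn_image_of_isOpenMap {X' Y Z : Type*} [TopologicalSpace X']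
    [TopologicalSpace Y] [TopologicalSpace Z] {π : X' → Y} (hπ : IsOpenMap π) {V : Set X'}
    (hV : IsOpen V) {ω : Y → Z} {g : X' → Z} (hg : ContinuousOn g V)
    (h : ∀ x ∈ V, ω (π x) = g x) : ContinuousOn ω (π '' V) := by
  rintro _ ⟨x, hx, rfl⟩
  have hgx : ContinuousAt g x := hV.continuousOn_iff.1 hg hx
  have heq : (ω ∘ π) =ᶠ[𝓝 x] g :=
    Filter.eventuallyEq_of_mem (hV.mem_nhds hx) fun x' hx' => h x' hx'
  have h1 : Tendsto (ω ∘ π) (𝓝 x) (𝓝 (ω (π x))) := by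
    rw [h x hx]
    exact hgx.tendsto.congr' heq.symm
  have h2 : ContinuousAt ω (π x) :=
    (Filter.tendsto_map'_iff.2 h1).mono_left (hπ.nhds_le x)
  exact h2.continuousWithinAt

/-- Scalar units are central in `GL_n` (Mathlib: the centre *is* the scalars). [folklore] -/
theorem scalar_mem_center (u : Kˣ) :
    GeneralLinearGroup.scalar (Fin n) u ∈ Subgroup.center (GL (Fin n) K) := by
  rw [GeneralLinearGroup.center_eq_range_scalar]
  exact MonoidHom.mem_range.2 ⟨u, rfl⟩

/-- **Continuous set-theoretic lifts of projective representations.** Every continuous map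
`r : Γ → GL_n(K) ⧸ centre` (quotient topology) on a compact Hausdorff totally disconnected space
`Γ` lifts to a continuous map `s : Γ → GL_n(K)`: around `σ₀` with `r σ₀ = [A₀]`, `a₀_{ij} ≠ 0`,
use the local section `[A] ↦ A / a_{ij}` on the open set `a_{ij} ≠ 0` of the quotient
(`QuotientGroup.isOpenMap_coe`; it is constant on the fibres, which are the scalar multiples
by `Matrix.GeneralLinearGroup.center_eq_range_scalar`), and glue on a clopen partition.  (No
group structure on `Γ` is needed.) [folklore] -/
theorem exists_continuous_lift_quotient_center {Γ : Type*} [TopologicalSpace Γ] [CompactSpace Γ]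
    [T2Space Γ] [TotallyDisconnectedSpace Γ]
    (r : Γ → GL (Fin n) K ⧸ Subgroup.center (GL (Fin n) K)) (hr : Continuous r) :
    ∃ s : Γ → GL (Fin n) K, Continuous s ∧
      ∀ σ, (QuotientGroup.mk (s σ) : GL (Fin n) K ⧸ Subgroup.center (GL (Fin n) K)) = r σ := by
  classical
  refine exists_continuous_of_forall_exists_nhds
    (fun σ A => (QuotientGroup.mk A : GL (Fin n) K ⧸ Subgroup.center (GL (Fin n) K)) = r σ)
    fun σ₀ => ?_
  rcases Nat.eq_zero_or_pos n with hn | hn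
  · subst hn
    refine ⟨Set.univ, isOpen_univ, Set.mem_univ _, fun _ => 1, continuousOn_const, fun τ _ => ?_⟩
    obtain ⟨g, hg⟩ := QuotientGroup.mk_surjective (r τ)
    rw [← hg, Subsingleton.elim g 1]
  · set A₀ : GL (Fin n) K := (r σ₀).out
    have hA₀ : (QuotientGroup.mk A₀ : GL (Fin n) K ⧸ Subgroup.center (GL (Fin n) K)) = r σ₀ :=
      QuotientGroup.out_eq' _
    set i : Fin n := ⟨0, hn⟩
    have hex : ∃ j, (A₀ : Matrix (Fin n) (Fin n) K) i j ≠ 0 := by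
      by_contra hall
      have hall' : ∀ j, (A₀ : Matrix (Fin n) (Fin n) K) i j = 0 := fun j =>
        not_not.1 fun hj => hall ⟨j, hj⟩
      have hunit : IsUnit (A₀ : Matrix (Fin n) (Fin n) K).det :=
        (Matrix.isUnit_iff_isUnit_det _).1 A₀.isUnit
      exact hunit.ne_zero (Matrix.det_eq_zero_of_row_eq_zero i hall')
    obtain ⟨j, hj⟩ := hex
    -- the open set `a_{ij} ≠ 0` of `GL_n(K)` (saturated for the centre) and the local section
    -- `g A = a_{ij}⁻¹ • A` on it (extended by the identity elsewhere)
    set V : Set (GL (Fin n) K) := {A | (A : Matrix (Fin n) (Fin n) K) i j ≠ 0}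
    have hVo : IsOpen V := isOpen_ne_fun (Units.continuous_val.matrix_elem i j) continuous_const
    obtain ⟨g, hg_def⟩ : ∃ g : GL (Fin n) K → GL (Fin n) K, g = fun A : GL (Fin n) K =>
        if h : (A : Matrix (Fin n) (Fin n) K) i j = 0 then A
        else GeneralLinearGroup.scalar (Fin n) (Units.mk0 _ h)⁻¹ * A := ⟨_, rfl⟩
    have hg_of_ne : ∀ {A : GL (Fin n) K} (h : (A : Matrix (Fin n) (Fin n) K) i j ≠ 0),
        g A = GeneralLinearGroup.scalar (Fin n) (Units.mk0 _ h)⁻¹ * A := by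
      intro A h
      simp only [hg_def]
      rw [dif_neg h]
    have hg_val : ∀ {A : GL (Fin n) K} (_ : (A : Matrix (Fin n) (Fin n) K) i j ≠ 0),
        (g A : Matrix (Fin n) (Fin n) K) =
          ((A : Matrix (Fin n) (Fin n) K) i j)⁻¹ • (A : Matrix (Fin n) (Fin n) K) := by
      intro A h
      rw [hg_of_ne h, Units.val_mul, GeneralLinearGroup.coe_scalar, Units.val_inv_eq_inv_val,
        Units.val_mk0, scalar_apply, ← smul_eq_diagonal_mul]
    have hg_inv_val : ∀ {A : GL (Fin n) K} (_ : (A : Matrix (Fin n) (Fin n) K) i j ≠ 0),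
        (((g A)⁻¹ : GL (Fin n) K) : Matrix (Fin n) (Fin n) K) =
          (A : Matrix (Fin n) (Fin n) K) i j • ((A⁻¹ : GL (Fin n) K) : Matrix (Fin n) (Fin n) K) := by
      intro A h
      rw [hg_of_ne h, _root_.mul_inv_rev, map_inv, inv_inv, Units.val_mul,
        GeneralLinearGroup.coe_scalar, Units.val_mk0, scalar_apply, ← smul_eq_mul_diagonal]
    have hg_mk : ∀ A : GL (Fin n) K,
        (QuotientGroup.mk (g A) : GL (Fin n) K ⧸ Subgroup.center (GL (Fin n) K)) =
          QuotientGroup.mk A := by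
      intro A
      by_cases h : (A : Matrix (Fin n) (Fin n) K) i j = 0
      · simp only [hg_def]
        rw [dif_pos h]
      · rw [hg_of_ne h, QuotientGroup.mk_mul,
          (QuotientGroup.eq_one_iff _).2 (scalar_mem_center _), one_mul]
    -- `g` is constant on the fibres over `V`
    have hg_fib : ∀ {A z : GL (Fin n) K}, A ∈ V → z ∈ Subgroup.center (GL (Fin n) K) →
        g (A * z) = g A := by
      intro A z hA hz
      rw [GeneralLinearGroup.center_eq_range_scalar] at hz
      obtain ⟨v, rfl⟩ := MonoidHom.mem_range.1 hz
      have hA' : (A : Matrix (Fin n) (Fin n) K) i j ≠ 0 := hA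
      have hval : ((A * GeneralLinearGroup.scalar (Fin n) v : GL (Fin n) K) :
          Matrix (Fin n) (Fin n) K) = (v : K) • (A : Matrix (Fin n) (Fin n) K) := by
        rw [Units.val_mul, GeneralLinearGroup.coe_scalar, scalar_apply, ← smul_eq_mul_diagonal]
      have hAz : ((A * GeneralLinearGroup.scalar (Fin n) v : GL (Fin n) K) :
          Matrix (Fin n) (Fin n) K) i j ≠ 0 := by
        rw [hval, Matrix.smul_apply, smul_eq_mul]
        exact mul_ne_zero v.ne_zero hA'
      ext1
      rw [hg_val hAz, hg_val hA', hval, smul_smul, Matrix.smul_apply, smul_eq_mul,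
        _root_.mul_inv_rev, mul_assoc, inv_mul_cancel₀ v.ne_zero, mul_one]
    -- `g` is continuous on `V`
    have hg_cont : ContinuousOn g V := by
      refine continuousOn_units ?_ ?_
      · have hc : ContinuousOn (fun A : GL (Fin n) K =>
            ((A : Matrix (Fin n) (Fin n) K) i j)⁻¹ • (A : Matrix (Fin n) (Fin n) K)) V :=
          ((Units.continuous_val.matrix_elem i j).continuousOn.inv₀ fun A hA => hA).smul
            Units.continuous_val.continuousOn
        exact hc.congr fun A hA => hg_val hA
      · have hc : ContinuousOn (fun A : GL (Fin n) K => (A : Matrix (Fin n) (Fin n) K) i j •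
            (((A⁻¹ : GL (Fin n) K)) : Matrix (Fin n) (Fin n) K)) V :=
          (Units.continuous_val.matrix_elem i j).continuousOn.smul
            Units.continuous_coe_inv.continuousOn
        exact hc.congr fun A hA => hg_inv_val hA
    have hVo' : IsOpen (QuotientGroup.mk '' V :
        Set (GL (Fin n) K ⧸ Subgroup.center (GL (Fin n) K))) :=
      QuotientGroup.isOpenMap_coe _ hVo
    refine ⟨r ⁻¹' (QuotientGroup.mk '' V), hVo'.preimage hr, ⟨A₀, hj, hA₀⟩,
      fun τ => g (r τ).out, ?_, ?_⟩
    · -- continuity: the section `ω q := g q.out` is continuous on the image of `V`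
      have hω : ContinuousOn
          (fun q : GL (Fin n) K ⧸ Subgroup.center (GL (Fin n) K) => g q.out)
          (QuotientGroup.mk '' V) := by
        refine continuousOn_image_of_isOpenMap QuotientGroup.isOpenMap_coe hVo hg_cont
          fun A hA => ?_
        obtain ⟨z, hz⟩ := QuotientGroup.mk_out_eq_mul (Subgroup.center (GL (Fin n) K)) A
        show g ((QuotientGroup.mk A : GL (Fin n) K ⧸ Subgroup.center (GL (Fin n) K)).out) = _
        rw [hz]
        exact hg_fib hA z.2
      exact hω.comp hr.continuousOn fun τ hτ => hτ
    · intro τ _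
      show (QuotientGroup.mk (g (r τ).out) : _ ⧸ _) = r τ
      rw [hg_mk, QuotientGroup.out_eq']

end Lift

/-! ### The reduction: lifting from the vanishing of the obstruction class -/

section Reduction

variable {K : Type*} [NormedField K] [IsAlgClosed K] {n : ℕ}
variable {Γ : Type*} [Group Γ] [TopologicalSpace Γ] [IsTopologicalGroup Γ] [CompactSpace Γ]
  [T2Space Γ] [TotallyDisconnectedSpace Γ]

/-- **The normalised lift and its obstruction cocycle (Patrikis 2019, proof of Prop. 1.0.18 for
`GL_n ↠ PGL_n`, isogeny complement `SL_n`).**  For a profinite group `Γ`, an algebraically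
closed normed field `K`, `n ≥ 1` and a continuous homomorphism `r : Γ → GL_n(K) ⧸ centre`,
there are a continuous set-theoretic lift `s : Γ → GL_n(K)` of `r` with `det s = 1` and a
continuous `μ_n(K)`-valued `2`-cocycle `z` (trivial action) with `s(σ) s(τ) = z(σ,τ) s(στ)`:
the obstruction class `c_n ∈ H²(Γ, μ_n)` of the printed proof.  Construction: a continuous
lift (`exists_continuous_lift_quotient_center`) divided by a continuous `n`-th root of its
determinant (`exists_continuous_pow_eq`); `s(σ)s(τ)s(στ)⁻¹` is central
(`Matrix.GeneralLinearGroup.center_eq_range_scalar`) of determinant `1`.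
[cite: Patrikis2019, §2.1 Prop. 1.0.18 (= Conrad, Lifting global representations, Prop. 5.3), proof] -/
theorem exists_normalized_lift_and_twoCocycle (hn : 0 < n)
    (r : Γ →ₜ* GL (Fin n) K ⧸ Subgroup.center (GL (Fin n) K)) :
    ∃ (s : Γ → GL (Fin n) K) (z : Γ → Γ → K), Continuous s ∧
      (∀ σ, (QuotientGroup.mk (s σ) : GL (Fin n) K ⧸ Subgroup.center (GL (Fin n) K)) = r σ) ∧
      (∀ σ, (s σ : Matrix (Fin n) (Fin n) K).det = 1) ∧
      Continuous (Function.uncurry z) ∧ (∀ σ τ, z σ τ ^ n = 1) ∧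
      (∀ σ τ υ, z σ τ * z (σ * τ) υ = z τ υ * z σ (τ * υ)) ∧
      ∀ σ τ, (s σ : Matrix (Fin n) (Fin n) K) * (s τ : Matrix (Fin n) (Fin n) K) =
        z σ τ • (s (σ * τ) : Matrix (Fin n) (Fin n) K) := by
  classical
  haveI : Nonempty (Fin n) := ⟨⟨0, hn⟩⟩
  set i₀ : Fin n := ⟨0, hn⟩
  -- Step 1: a continuous set-theoretic lift.
  obtain ⟨s₀, hs₀, hs₀r⟩ := exists_continuous_lift_quotient_center (⇑r) (map_continuous r)
  -- Step 2: a continuous `n`-th root of its determinant.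
  have hd : Continuous fun σ => (s₀ σ : Matrix (Fin n) (Fin n) K).det :=
    (Units.continuous_val.comp hs₀).matrix_det
  have hd0 : ∀ σ, (s₀ σ : Matrix (Fin n) (Fin n) K).det ≠ 0 := fun σ =>
    ((Matrix.isUnit_iff_isUnit_det _).1 (s₀ σ).isUnit).ne_zero
  obtain ⟨e, he, hen⟩ := exists_continuous_pow_eq hn hd hd0
  have he0 : ∀ σ, e σ ≠ 0 := fun σ h0 => hd0 σ (by rw [← hen σ, h0, zero_pow hn.ne'])
  -- Step 3: the normalised lift `s = e⁻¹ s₀`, `det s = 1` (values in the isogeny complement `SL_n`).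
  obtain ⟨s, hs_def⟩ : ∃ s : Γ → GL (Fin n) K,
      s = fun σ => GeneralLinearGroup.scalar (Fin n) (Units.mk0 (e σ) (he0 σ))⁻¹ * s₀ σ :=
    ⟨_, rfl⟩
  have hs_val : ∀ σ, (s σ : Matrix (Fin n) (Fin n) K) =
      (e σ)⁻¹ • (s₀ σ : Matrix (Fin n) (Fin n) K) := by
    intro σ
    simp only [hs_def, Units.val_mul, GeneralLinearGroup.coe_scalar, Units.val_inv_eq_inv_val,
      Units.val_mk0, scalar_apply, ← smul_eq_diagonal_mul]
  have hs_inv_val : ∀ σ, (((s σ)⁻¹ : GL (Fin n) K) : Matrix (Fin n) (Fin n) K) =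
      e σ • (((s₀ σ)⁻¹ : GL (Fin n) K) : Matrix (Fin n) (Fin n) K) := by
    intro σ
    simp only [hs_def, _root_.mul_inv_rev, map_inv, inv_inv, Units.val_mul,
      GeneralLinearGroup.coe_scalar, Units.val_mk0, scalar_apply, ← smul_eq_mul_diagonal]
  have hs_cont : Continuous s := by
    refine continuous_units ?_ ?_
    · simp_rw [hs_val]
      exact (he.inv₀ he0).smul (Units.continuous_val.comp hs₀)
    · simp_rw [hs_inv_val]
      exact he.smul (Units.continuous_coe_inv.comp hs₀)
  have hs_r : ∀ σ, (QuotientGroup.mk (s σ) : GL (Fin n) K ⧸ Subgroup.center (GL (Fin n) K)) =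
      r σ := by
    intro σ
    simp only [hs_def]
    rw [QuotientGroup.mk_mul, (QuotientGroup.eq_one_iff _).2 (scalar_mem_center _), one_mul,
      hs₀r]
  have hs_det : ∀ σ, (s σ : Matrix (Fin n) (Fin n) K).det = 1 := by
    intro σ
    rw [hs_val, det_smul, Fintype.card_fin, inv_pow, hen σ, inv_mul_cancel₀ (hd0 σ)]
  have hS_ne : ∀ σ, (s σ : Matrix (Fin n) (Fin n) K) ≠ 0 := by
    intro σ h
    have := hs_det σ
    rw [h, det_zero] at this
    exact zero_ne_one this
  -- Step 4: the obstruction cocycle `c(σ,τ) = s σ s τ (s στ)⁻¹`, central of determinant one.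
  obtain ⟨c, hc_def⟩ : ∃ c : Γ → Γ → GL (Fin n) K, c = fun σ τ => s σ * s τ * (s (σ * τ))⁻¹ :=
    ⟨_, rfl⟩
  have hc_mem : ∀ σ τ, c σ τ ∈ Subgroup.center (GL (Fin n) K) := by
    intro σ τ
    rw [← QuotientGroup.eq_one_iff, hc_def]
    simp only [QuotientGroup.mk_mul, QuotientGroup.mk_inv, hs_r, ← map_mul, mul_inv_cancel]
  have hcu : ∀ σ τ, ∃ u : Kˣ, GeneralLinearGroup.scalar (Fin n) u = c σ τ := by
    intro σ τ
    have := hc_mem σ τ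
    rw [GeneralLinearGroup.center_eq_range_scalar] at this
    exact MonoidHom.mem_range.1 this
  obtain ⟨z, hz_def⟩ : ∃ z : Γ → Γ → K, z = fun σ τ => (c σ τ : Matrix (Fin n) (Fin n) K) i₀ i₀ :=
    ⟨_, rfl⟩
  have key : ∀ σ τ, (s σ : Matrix (Fin n) (Fin n) K) * (s τ : Matrix (Fin n) (Fin n) K) =
      z σ τ • (s (σ * τ) : Matrix (Fin n) (Fin n) K) := by
    intro σ τ
    obtain ⟨u, hu⟩ := hcu σ τ
    have hzu : z σ τ = (u : K) := by
      simp only [hz_def, ← hu, GeneralLinearGroup.coe_scalar, scalar_apply, diagonal_apply_eq]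
    have hmul : s σ * s τ = c σ τ * s (σ * τ) := by
      simp only [hc_def, inv_mul_cancel_right]
    have hmul' := congrArg (fun A : GL (Fin n) K => (A : Matrix (Fin n) (Fin n) K)) hmul
    simp only [Units.val_mul] at hmul'
    rw [hmul', ← hu, GeneralLinearGroup.coe_scalar, scalar_apply, hzu, smul_eq_diagonal_mul]
  have hc_cont : Continuous fun p : Γ × Γ => c p.1 p.2 := by
    rw [hc_def]
    exact ((hs_cont.comp continuous_fst).mul (hs_cont.comp continuous_snd)).mul
      (hs_cont.comp continuous_mul).inv
  have hz_cont : Continuous (Function.uncurry z) := by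
    rw [hz_def]
    exact (Units.continuous_val.comp hc_cont).matrix_elem i₀ i₀
  have hz_pow : ∀ σ τ, z σ τ ^ n = 1 := by
    intro σ τ
    have h := congrArg Matrix.det (key σ τ)
    rw [det_mul, det_smul, hs_det, hs_det, hs_det, Fintype.card_fin, mul_one, mul_one] at h
    exact h.symm
  have hz_cocycle : ∀ σ τ υ, z σ τ * z (σ * τ) υ = z τ υ * z σ (τ * υ) := by
    intro σ τ υ
    have h1 : (s σ : Matrix (Fin n) (Fin n) K) * (s τ : Matrix (Fin n) (Fin n) K) *
        (s υ : Matrix (Fin n) (Fin n) K) =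
        (z σ τ * z (σ * τ) υ) • (s (σ * τ * υ) : Matrix (Fin n) (Fin n) K) := by
      rw [key σ τ, smul_mul_assoc, key (σ * τ) υ, smul_smul]
    have h2 : (s σ : Matrix (Fin n) (Fin n) K) * ((s τ : Matrix (Fin n) (Fin n) K) *
        (s υ : Matrix (Fin n) (Fin n) K)) =
        (z τ υ * z σ (τ * υ)) • (s (σ * (τ * υ)) : Matrix (Fin n) (Fin n) K) := by
      rw [key τ υ, mul_smul_comm, key σ (τ * υ), smul_smul]
    rw [mul_assoc (s σ : Matrix (Fin n) (Fin n) K), h2, ← mul_assoc σ τ υ] at h1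
    exact (smul_left_injective K (hS_ne (σ * τ * υ)) h1).symm
  exact ⟨s, z, hs_cont, hs_r, hs_det, hz_cont, hz_pow, hz_cocycle, key⟩

omit [IsAlgClosed K] [IsTopologicalGroup Γ] [CompactSpace Γ] [T2Space Γ] [TotallyDisconnectedSpace Γ] in
/-- **Twisting a projective lift by a splitting cochain.**  If `s : Γ → GL_n(K)` is continuous
with `s(σ) s(τ) = z(σ,τ) s(στ)` for scalars `z(σ,τ)`, and a continuous nowhere-vanishing
`b : Γ → K` splits `z` (`z(σ,τ) b(στ) = b(σ) b(τ)`), then `W := b⁻¹ s` is a continuous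
homomorphism `Γ → GL_n(K)` with the same image in `PGL_n(K)` as `s`.
[cite: Patrikis2019, §2.1 Prop. 1.0.18, proof] -/
theorem exists_continuousMonoidHom_of_split {s : Γ → GL (Fin n) K} (hs : Continuous s)
    {z : Γ → Γ → K}
    (key : ∀ σ τ, (s σ : Matrix (Fin n) (Fin n) K) * (s τ : Matrix (Fin n) (Fin n) K) =
      z σ τ • (s (σ * τ) : Matrix (Fin n) (Fin n) K))
    {b : Γ → K} (hb : Continuous b) (hb0 : ∀ σ, b σ ≠ 0)
    (hbz : ∀ σ τ, z σ τ * b (σ * τ) = b σ * b τ) :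
    ∃ W : Γ →ₜ* GL (Fin n) K,
      (∀ σ, (QuotientGroup.mk (W σ) : GL (Fin n) K ⧸ Subgroup.center (GL (Fin n) K)) =
        QuotientGroup.mk (s σ)) ∧
      ∀ σ, ((W σ : GL (Fin n) K) : Matrix (Fin n) (Fin n) K) =
        (b σ)⁻¹ • (s σ : Matrix (Fin n) (Fin n) K) := by
  classical
  have hz0 : ∀ σ τ, z σ τ ≠ 0 := fun σ τ =>
    left_ne_zero_of_mul (by rw [hbz σ τ]; exact mul_ne_zero (hb0 σ) (hb0 τ))
  have hcoef : ∀ σ τ, (b σ)⁻¹ * (b τ)⁻¹ * z σ τ = (b (σ * τ))⁻¹ := by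
    intro σ τ
    rw [← mul_inv, ← hbz σ τ, mul_inv, mul_comm (z σ τ)⁻¹, mul_assoc, inv_mul_cancel₀ (hz0 σ τ),
      mul_one]
  obtain ⟨w, hw_def⟩ : ∃ w : Γ → GL (Fin n) K,
      w = fun σ => GeneralLinearGroup.scalar (Fin n) (Units.mk0 (b σ) (hb0 σ))⁻¹ * s σ :=
    ⟨_, rfl⟩
  have hw_val : ∀ σ, (w σ : Matrix (Fin n) (Fin n) K) =
      (b σ)⁻¹ • (s σ : Matrix (Fin n) (Fin n) K) := by
    intro σ
    simp only [hw_def, Units.val_mul, GeneralLinearGroup.coe_scalar, Units.val_inv_eq_inv_val,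
      Units.val_mk0, scalar_apply, ← smul_eq_diagonal_mul]
  have hw_inv_val : ∀ σ, (((w σ)⁻¹ : GL (Fin n) K) : Matrix (Fin n) (Fin n) K) =
      b σ • (((s σ)⁻¹ : GL (Fin n) K) : Matrix (Fin n) (Fin n) K) := by
    intro σ
    simp only [hw_def, _root_.mul_inv_rev, map_inv, inv_inv, Units.val_mul,
      GeneralLinearGroup.coe_scalar, Units.val_mk0, scalar_apply, ← smul_eq_mul_diagonal]
  have hw_cont : Continuous w := by
    refine continuous_units ?_ ?_
    · simp_rw [hw_val]
      exact (hb.inv₀ hb0).smul (Units.continuous_val.comp hs)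
    · simp_rw [hw_inv_val]
      exact hb.smul (Units.continuous_coe_inv.comp hs)
  have hw_mul : ∀ σ τ, w (σ * τ) = w σ * w τ := by
    intro σ τ
    ext1
    rw [Units.val_mul, hw_val, hw_val, hw_val, smul_mul_assoc, mul_smul_comm, smul_smul, key σ τ,
      smul_smul, hcoef]
  have hw_mk : ∀ σ, (QuotientGroup.mk (w σ) : GL (Fin n) K ⧸ Subgroup.center (GL (Fin n) K)) =
      QuotientGroup.mk (s σ) := by
    intro σ
    simp only [hw_def]
    rw [QuotientGroup.mk_mul, (QuotientGroup.eq_one_iff _).2 (scalar_mem_center _), one_mul]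
  exact ⟨⟨MonoidHom.mk' w hw_mul, hw_cont⟩, hw_mk, hw_val⟩

/-- **Tate–Conrad–Patrikis reduction (Patrikis 2019, proof of Prop. 1.0.18 for
`GL_n ↠ PGL_n`).** Let `Γ` be a profinite group and `K` an algebraically closed normed field.
Suppose that every continuous `μ_n(K)`-valued `2`-cocycle `z` on `Γ` (trivial action:
`z(σ,τ) z(στ,υ) = z(τ,υ) z(σ,τυ)`) is the coboundary of a continuous cochain `b : Γ → Kˣ`
(`z(σ,τ) b(στ) = b(σ) b(τ)`), i.e. that `H²(Γ, μ_n) → H²(Γ, Kˣ)` vanishes — for `Γ = Γ_F`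
this is supplied by Tate's theorem `H²(Γ_F, ℚ/ℤ) = 0`.  Then every continuous homomorphism
`r : Γ → PGL_n(K) = GL_n(K) ⧸ centre` lifts to a continuous homomorphism `W : Γ → GL_n(K)`.
Proof: a continuous set-theoretic lift `s` (`exists_continuous_lift_quotient_center`) can be
normalised to `det s = 1` (`exists_continuous_pow_eq`, the isogeny complement `SL_n`); then
`s(σ) s(τ) = z(σ,τ) s(στ)` with `z` central of determinant `1`, i.e. `z ∈ μ_n`, a continuous
`2`-cocycle (the obstruction class `c_n`); if `z b(στ) = b(σ) b(τ)` then `W = b⁻¹ s` is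
multiplicative.
[cite: Patrikis2019, §2.1 Prop. 1.0.18 (= Conrad, Lifting global representations, Prop. 5.3), proof] -/
theorem exists_continuousMonoidHom_lift_of_twoCocycle
    (hH2 : ∀ z : Γ → Γ → K, Continuous (Function.uncurry z) → (∀ σ τ, z σ τ ^ n = 1) →
      (∀ σ τ υ, z σ τ * z (σ * τ) υ = z τ υ * z σ (τ * υ)) →
      ∃ b : Γ → K, Continuous b ∧ (∀ σ, b σ ≠ 0) ∧ ∀ σ τ, z σ τ * b (σ * τ) = b σ * b τ)
    (r : Γ →ₜ* GL (Fin n) K ⧸ Subgroup.center (GL (Fin n) K)) :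
    ∃ W : Γ →ₜ* GL (Fin n) K,
      ∀ σ, (QuotientGroup.mk (W σ) : GL (Fin n) K ⧸ Subgroup.center (GL (Fin n) K)) = r σ := by
  classical
  rcases Nat.eq_zero_or_pos n with hn | hn
  · subst hn
    refine ⟨1, fun σ => ?_⟩
    obtain ⟨g, hg⟩ := QuotientGroup.mk_surjective (r σ)
    rw [← hg, Subsingleton.elim g ((1 : Γ →ₜ* GL (Fin 0) K) σ)]
  obtain ⟨s, z, hs, hs_r, -, hz_cont, hz_pow, hz_coc, key⟩ :=
    exists_normalized_lift_and_twoCocycle hn r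
  obtain ⟨b, hb, hb0, hbz⟩ := hH2 z hz_cont hz_pow hz_coc
  obtain ⟨W, hW_mk, -⟩ := exists_continuousMonoidHom_of_split hs key hb hb0 hbz
  exact ⟨W, fun σ => (hW_mk σ).trans (hs_r σ)⟩

/-- **The reduction with finite-order determinant (Patrikis 2019, Remark 1.0.19 (2): "in the
case of `GL_n → PGL_n`, this proof produces lifts with finite-order determinant").**  If every
continuous `μ_n(K)`-valued `2`-cocycle on `Γ` is split by a continuous cochain with values in
the roots of unity `μ_N(K)` for some `N ≥ 1` (for `Γ = Γ_F` this is what Tate's theorem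
`lim→ H²(Γ_F, ℤ/N) = H²(Γ_F, ℚ/ℤ) = 0` gives), then every continuous
`r : Γ → GL_n(K) ⧸ centre` has a continuous homomorphic lift `W` with `(det W)^N = 1` for some
`N ≥ 1` (`det (b⁻¹ s) = b⁻ⁿ`).
[cite: Patrikis2019, §2.1 Remark 1.0.19 (2)] -/
theorem exists_continuousMonoidHom_lift_det_pow_eq_one_of_twoCocycle
    (hH2 : ∀ z : Γ → Γ → K, Continuous (Function.uncurry z) → (∀ σ τ, z σ τ ^ n = 1) →
      (∀ σ τ υ, z σ τ * z (σ * τ) υ = z τ υ * z σ (τ * υ)) →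
      ∃ (N : ℕ) (b : Γ → K), 0 < N ∧ Continuous b ∧ (∀ σ, b σ ^ N = 1) ∧
        ∀ σ τ, z σ τ * b (σ * τ) = b σ * b τ)
    (r : Γ →ₜ* GL (Fin n) K ⧸ Subgroup.center (GL (Fin n) K)) :
    ∃ (W : Γ →ₜ* GL (Fin n) K) (N : ℕ), 0 < N ∧
      (∀ σ, (QuotientGroup.mk (W σ) : GL (Fin n) K ⧸ Subgroup.center (GL (Fin n) K)) = r σ) ∧
      ∀ σ, ((W σ : GL (Fin n) K) : Matrix (Fin n) (Fin n) K).det ^ N = 1 := by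
  classical
  rcases Nat.eq_zero_or_pos n with hn | hn
  · subst hn
    refine ⟨1, 1, one_pos, fun σ => ?_, fun σ => ?_⟩
    · obtain ⟨g, hg⟩ := QuotientGroup.mk_surjective (r σ)
      rw [← hg, Subsingleton.elim g ((1 : Γ →ₜ* GL (Fin 0) K) σ)]
    · rw [Matrix.det_isEmpty, one_pow]
  obtain ⟨s, z, hs, hs_r, hs_det, hz_cont, hz_pow, hz_coc, key⟩ :=
    exists_normalized_lift_and_twoCocycle hn r
  obtain ⟨N, b, hN, hb, hbN, hbz⟩ := hH2 z hz_cont hz_pow hz_coc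
  have hb0 : ∀ σ, b σ ≠ 0 := fun σ h0 => by
    have := hbN σ
    rw [h0, zero_pow hN.ne'] at this
    exact zero_ne_one this
  obtain ⟨W, hW_mk, hW_val⟩ := exists_continuousMonoidHom_of_split hs key hb hb0 hbz
  refine ⟨W, N, hN, fun σ => (hW_mk σ).trans (hs_r σ), fun σ => ?_⟩
  rw [hW_val, det_smul, hs_det, mul_one, Fintype.card_fin, ← pow_mul, pow_mul', inv_pow, hbN,
    inv_one, one_pow]

end Reduction

/-! ### From Tate's theorem in `ℚ/ℤ`-form to the splitting hypothesis -/

section Bridge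

variable {K : Type*} [NormedField K] [IsAlgClosed K] [CharZero K]
variable {Γ : Type*} [Group Γ] [TopologicalSpace Γ] [CompactSpace Γ]

/-- Two fractions `u/N`, `v/N` (`u v : ℤ`) agree in `ℚ/ℤ = AddCircle (1 : ℚ)` iff `N ∣ u - v`.
[folklore] -/
private theorem intCast_div_eq_intCast_div_iff {N : ℕ} (hN : N ≠ 0) (u v : ℤ) :
    (((u : ℚ) / N : ℚ) : AddCircle (1 : ℚ)) = (((v : ℚ) / N : ℚ) : AddCircle (1 : ℚ)) ↔
      (N : ℤ) ∣ u - v := by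
  rw [QuotientAddGroup.eq_iff_sub_mem, AddSubgroup.mem_zmultiples_iff]
  have hN' : (N : ℚ) ≠ 0 := Nat.cast_ne_zero.2 hN
  constructor
  · rintro ⟨m, hm⟩
    rw [zsmul_eq_mul, mul_one, div_sub_div_same, eq_div_iff hN'] at hm
    refine ⟨m, ?_⟩
    have hm' : ((u - v : ℤ) : ℚ) = ((N * m : ℤ) : ℚ) := by push_cast; linarith
    exact_mod_cast hm'
  · rintro ⟨c, hc⟩
    refine ⟨c, ?_⟩
    rw [zsmul_eq_mul, mul_one, div_sub_div_same, eq_div_iff hN']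
    have h : ((u - v : ℤ) : ℚ) = ((N * c : ℤ) : ℚ) := by rw [hc]
    push_cast at h
    linarith

/-- An `N`-torsion element of `ℚ/ℤ = AddCircle (1 : ℚ)` is a fraction `k/N`. [folklore] -/
private theorem exists_eq_intCast_div_of_nsmul_eq_zero {N : ℕ} (hN : N ≠ 0)
    {x : AddCircle (1 : ℚ)} (hx : N • x = 0) :
    ∃ k : ℤ, x = (((k : ℚ) / N : ℚ) : AddCircle (1 : ℚ)) := by
  obtain ⟨q, rfl⟩ := QuotientAddGroup.mk_surjective x
  rw [← QuotientAddGroup.mk_nsmul, QuotientAddGroup.eq_zero_iff, AddSubgroup.mem_zmultiples_iff]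
    at hx
  obtain ⟨m, hm⟩ := hx
  rw [zsmul_eq_mul, mul_one, nsmul_eq_mul] at hm
  refine ⟨m, ?_⟩
  congr 1
  rw [eq_div_iff (Nat.cast_ne_zero.2 hN : (N : ℚ) ≠ 0), hm, mul_comm]

/-- Every element of `ℚ/ℤ = AddCircle (1 : ℚ)` is torsion. [folklore] -/
private theorem exists_nsmul_eq_zero_addCircle (x : AddCircle (1 : ℚ)) :
    ∃ m : ℕ, 0 < m ∧ m • x = 0 := by
  obtain ⟨q, rfl⟩ := QuotientAddGroup.mk_surjective x
  refine ⟨q.den, q.den_pos, ?_⟩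
  rw [← QuotientAddGroup.mk_nsmul, QuotientAddGroup.eq_zero_iff, AddSubgroup.mem_zmultiples_iff]
  refine ⟨q.num, ?_⟩
  rw [zsmul_eq_mul, mul_one, nsmul_eq_mul, mul_comm, Rat.mul_den_eq_num]

/-- **From Tate's theorem in cochain form to the splitting of `μ_n`-valued cocycles in `μ_N`.**
Let `Γ` be a compact topological group and `K` an algebraically closed normed field of
characteristic zero.  Suppose `H²(Γ, ℚ/ℤ) = 0` in the concrete sense that every locally
constant `2`-cocycle `f : Γ × Γ → ℚ/ℤ = AddCircle (1 : ℚ)` (trivial action) is the coboundary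
of a locally constant cochain — for `Γ = Γ_F` this is Tate's theorem (Patrikis Thm. 1.0.16;
Serre's Durham survey, Thm. 4).  Then every continuous `μ_n(K)`-valued `2`-cocycle `z` on `Γ`
(`n ≥ 1`) is the coboundary of a continuous cochain with values in `μ_N(K)` for some `N ≥ 1`
(so in particular the hypotheses of `exists_continuousMonoidHom_lift_of_twoCocycle` and of
`exists_continuousMonoidHom_lift_det_pow_eq_one_of_twoCocycle` hold).  Proof ("`lim→ H²(Γ_F,
ℤ/n) = H²(Γ_F, ℚ/ℤ) = 0`"): write `z = ζ^a` for a primitive `n`-th root of unity `ζ` (discrete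
logarithm; `z` is locally constant by `isLocallyConstant_of_pow_eq_one`), push the `ℤ/n`-valued
cocycle `a` into `ℚ/ℤ` as `a/n`, split it there as `δb`; `b` has finite image (compactness),
hence values in `(1/N)ℤ/ℤ` for some `N = nM`, and `b ↦ ξ^{N b}` with `ξ^M = ζ`, `ξ^N = 1`
turns the additive splitting into a multiplicative one with values in `μ_N`.
[cite: Patrikis2019, §2.1 Prop. 1.0.18, proof ("Tate's theorem tells us that lim→ H²(Γ_F, ℤ/n) = H²(Γ_F, ℚ/ℤ) = 0") and Remark 1.0.19 (2)] -/
theorem twoCocycle_split_pow_eq_one_of_addCircle {n : ℕ} (hn : 0 < n)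
    (H : ∀ f : Γ → Γ → AddCircle (1 : ℚ), IsLocallyConstant (Function.uncurry f) →
      (∀ σ τ υ, f σ τ + f (σ * τ) υ = f τ υ + f σ (τ * υ)) →
      ∃ b : Γ → AddCircle (1 : ℚ), IsLocallyConstant b ∧ ∀ σ τ, f σ τ + b (σ * τ) = b σ + b τ)
    (z : Γ → Γ → K) (hzc : Continuous (Function.uncurry z)) (hzn : ∀ σ τ, z σ τ ^ n = 1)
    (hzz : ∀ σ τ υ, z σ τ * z (σ * τ) υ = z τ υ * z σ (τ * υ)) :
    ∃ (N : ℕ) (b : Γ → K), 0 < N ∧ Continuous b ∧ (∀ σ, b σ ^ N = 1) ∧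
      ∀ σ τ, z σ τ * b (σ * τ) = b σ * b τ := by
  classical
  haveI : NeZero (n : K) := ⟨Nat.cast_ne_zero.2 hn.ne'⟩
  haveI : NeZero n := ⟨hn.ne'⟩
  obtain ⟨ζ, hζ⟩ := HasEnoughRootsOfUnity.exists_primitiveRoot K n
  have hζ0 : ζ ≠ 0 := hζ.ne_zero hn.ne'
  -- exponents of `ζ` are determined modulo `n`
  have hexp : ∀ {i j : ℕ}, ζ ^ i = ζ ^ j → (n : ℤ) ∣ (i : ℤ) - j := by
    intro i j hij
    rw [← hζ.zpow_eq_one_iff_dvd, zpow_sub₀ hζ0, zpow_natCast, zpow_natCast, hij,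
      div_self (pow_ne_zero _ hζ0)]
  -- discrete logarithm to the base `ζ` on `μ_n(K)`
  obtain ⟨dlog, hdlog_def⟩ : ∃ dlog : K → ℕ, dlog = fun ξ =>
      if hξ : ξ ^ n = 1 then Classical.choose (hζ.eq_pow_of_pow_eq_one hξ) else 0 := ⟨_, rfl⟩
  have hdlog : ∀ {ξ : K}, ξ ^ n = 1 → ζ ^ dlog ξ = ξ := by
    intro ξ hξ
    simp only [hdlog_def]
    rw [dif_pos hξ]
    exact (Classical.choose_spec (hζ.eq_pow_of_pow_eq_one hξ)).2
  have ha : ∀ σ τ, ζ ^ dlog (z σ τ) = z σ τ := fun σ τ => hdlog (hzn σ τ)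
  have hzlc : IsLocallyConstant (Function.uncurry z) :=
    isLocallyConstant_of_pow_eq_one hn hzc fun p => hzn p.1 p.2
  -- the `ℚ/ℤ`-valued cocycle `f = dlog(z) / n`
  obtain ⟨f, hf_def⟩ : ∃ f : Γ → Γ → AddCircle (1 : ℚ),
      f = fun σ τ => (((dlog (z σ τ) : ℚ) / n : ℚ) : AddCircle (1 : ℚ)) := ⟨_, rfl⟩
  have hf_lc : IsLocallyConstant (Function.uncurry f) := by
    rw [hf_def]
    exact hzlc.comp fun ξ : K => (((dlog ξ : ℚ) / n : ℚ) : AddCircle (1 : ℚ))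
  have hf_coc : ∀ σ τ υ, f σ τ + f (σ * τ) υ = f τ υ + f σ (τ * υ) := by
    intro σ τ υ
    simp only [hf_def]
    rw [← QuotientAddGroup.mk_add, ← QuotientAddGroup.mk_add, ← add_div, ← add_div]
    have key : (n : ℤ) ∣ ((dlog (z σ τ) + dlog (z (σ * τ) υ) : ℕ) : ℤ) -
        ((dlog (z τ υ) + dlog (z σ (τ * υ)) : ℕ) : ℤ) :=
      hexp (by rw [pow_add, pow_add, ha, ha, ha, ha, hzz])
    have h := (intCast_div_eq_intCast_div_iff hn.ne' _ _).2 key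
    push_cast at h
    exact h
  -- Tate: `f` splits in `ℚ/ℤ`
  obtain ⟨bq, hbq_lc, hbq⟩ := H f hf_lc hf_coc
  -- `bq` has finite image, hence bounded denominators: `M • bq = 0`
  have hfin : (Set.range bq).Finite := hbq_lc.range_finite
  choose m hm0 hmx using exists_nsmul_eq_zero_addCircle
  set M : ℕ := ∏ x ∈ hfin.toFinset, m x with hM_def
  have hM0 : 0 < M := Finset.prod_pos fun x _ => hm0 x
  have hMb : ∀ σ, M • bq σ = 0 := by
    intro σ
    have hmem : bq σ ∈ hfin.toFinset := by
      rw [Set.Finite.mem_toFinset]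
      exact ⟨σ, rfl⟩
    obtain ⟨c, hc⟩ := Finset.dvd_prod_of_mem m hmem
    rw [← hM_def] at hc
    rw [hc, mul_nsmul, hmx, nsmul_zero]
  set N : ℕ := n * M with hN_def
  have hN0 : N ≠ 0 := (Nat.mul_pos hn hM0).ne'
  have hNb : ∀ σ, N • bq σ = 0 := by
    intro σ
    rw [hN_def, mul_comm, mul_nsmul, hMb, nsmul_zero]
  -- representatives `κ x / N` of the `N`-torsion values
  have hrep : ∀ x : AddCircle (1 : ℚ), ∃ k : ℤ,
      N • x = 0 → x = (((k : ℚ) / N : ℚ) : AddCircle (1 : ℚ)) := by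
    intro x
    by_cases hx : N • x = 0
    · obtain ⟨k, hk⟩ := exists_eq_intCast_div_of_nsmul_eq_zero hN0 hx
      exact ⟨k, fun _ => hk⟩
    · exact ⟨0, fun h => absurd h hx⟩
  choose κ hκ using hrep
  -- an `M`-th root `ξ` of `ζ`: `ξ ^ N = 1`
  obtain ⟨ξ, hξM⟩ := IsAlgClosed.exists_pow_nat_eq ζ hM0
  have hξ0 : ξ ≠ 0 := by
    intro h0
    rw [h0, zero_pow hM0.ne'] at hξM
    exact hζ0 hξM.symm
  set ξu : Kˣ := Units.mk0 ξ hξ0 with hξu_def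
  have hξuN : ξu ^ N = 1 := by
    ext
    rw [Units.val_pow_eq_pow_val, Units.val_mk0, hN_def, mul_comm, pow_mul, hξM, hζ.pow_eq_one,
      Units.val_one]
  have hξpow : ∀ {e₁ e₂ : ℤ}, (N : ℤ) ∣ e₁ - e₂ → ξu ^ e₁ = ξu ^ e₂ := by
    rintro e₁ e₂ ⟨c, hc⟩
    rw [show e₁ = e₂ + N * c by linarith, zpow_add, zpow_mul, zpow_natCast, hξuN, one_zpow,
      mul_one]
  have hξz : ∀ σ τ, ((ξu ^ ((dlog (z σ τ) * M : ℕ) : ℤ) : Kˣ) : K) = z σ τ := by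
    intro σ τ
    rw [zpow_natCast, Units.val_pow_eq_pow_val, Units.val_mk0, mul_comm, pow_mul, hξM, ha]
  -- the multiplicative splitting `B = ξ ^ (N bq)`
  refine ⟨N, fun σ => ((ξu ^ κ (bq σ) : Kˣ) : K), Nat.pos_of_ne_zero hN0, ?_, fun σ => ?_,
    fun σ τ => ?_⟩
  · exact (hbq_lc.comp fun x => ((ξu ^ κ x : Kˣ) : K)).continuous
  · show ((ξu ^ κ (bq σ) : Kˣ) : K) ^ N = 1
    rw [← Units.val_pow_eq_pow_val, ← zpow_natCast, ← zpow_mul, zpow_mul', zpow_natCast, hξuN,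
      one_zpow, Units.val_one]
  · have hf_rep : f σ τ = ((((dlog (z σ τ) * M : ℕ) : ℤ) : ℚ) / N : ℚ) := by
      simp only [hf_def]
      congr 1
      rw [hN_def]
      push_cast
      rw [mul_div_mul_right _ _ (Nat.cast_ne_zero.2 hM0.ne' : (M : ℚ) ≠ 0)]
    have h := hbq σ τ
    rw [hf_rep, hκ (bq (σ * τ)) (hNb _), hκ (bq σ) (hNb _), hκ (bq τ) (hNb _),
      ← QuotientAddGroup.mk_add, ← QuotientAddGroup.mk_add, ← add_div, ← add_div] at h
    have hdvd : (N : ℤ) ∣ (((dlog (z σ τ) * M : ℕ) : ℤ) + κ (bq (σ * τ))) -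
        (κ (bq σ) + κ (bq τ)) := by
      refine (intCast_div_eq_intCast_div_iff hN0 _ _).1 ?_
      push_cast at h ⊢
      exact h
    have hunits : ξu ^ (((dlog (z σ τ) * M : ℕ) : ℤ)) * ξu ^ κ (bq (σ * τ)) =
        ξu ^ κ (bq σ) * ξu ^ κ (bq τ) := by
      rw [← zpow_add, ← zpow_add]
      exact hξpow hdvd
    have hval := congrArg (fun u : Kˣ => (u : K)) hunits
    simp only [Units.val_mul] at hval
    rw [hξz] at hval
    exact hval

/-- **From Tate's theorem in cochain form to the splitting of `μ_n`-valued cocycles.**  Let `Γ`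
be a compact topological group and `K` an algebraically closed normed field of characteristic
zero.  Suppose `H²(Γ, ℚ/ℤ) = 0` in the concrete sense that every locally constant `2`-cocycle
`f : Γ × Γ → ℚ/ℤ = AddCircle (1 : ℚ)` (trivial action) is the coboundary of a locally constant
cochain — for `Γ = Γ_F` this is Tate's theorem (Patrikis Thm. 1.0.16; Serre's Durham survey,
Thm. 4).  Then every continuous `μ_n(K)`-valued `2`-cocycle `z` on `Γ` is the coboundary of a
continuous `Kˣ`-valued cochain, i.e. the hypothesis of
`exists_continuousMonoidHom_lift_of_twoCocycle` holds (a weakening of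
`twoCocycle_split_pow_eq_one_of_addCircle`).
[cite: Patrikis2019, §2.1 Prop. 1.0.18, proof ("Tate's theorem tells us that lim→ H²(Γ_F, ℤ/n) = H²(Γ_F, ℚ/ℤ) = 0")] -/
theorem twoCocycle_split_of_addCircle {n : ℕ} (hn : 0 < n)
    (H : ∀ f : Γ → Γ → AddCircle (1 : ℚ), IsLocallyConstant (Function.uncurry f) →
      (∀ σ τ υ, f σ τ + f (σ * τ) υ = f τ υ + f σ (τ * υ)) →
      ∃ b : Γ → AddCircle (1 : ℚ), IsLocallyConstant b ∧ ∀ σ τ, f σ τ + b (σ * τ) = b σ + b τ)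
    (z : Γ → Γ → K) (hzc : Continuous (Function.uncurry z)) (hzn : ∀ σ τ, z σ τ ^ n = 1)
    (hzz : ∀ σ τ υ, z σ τ * z (σ * τ) υ = z τ υ * z σ (τ * υ)) :
    ∃ b : Γ → K, Continuous b ∧ (∀ σ, b σ ≠ 0) ∧ ∀ σ τ, z σ τ * b (σ * τ) = b σ * b τ := by
  obtain ⟨N, b, hN, hb, hbN, hbz⟩ := twoCocycle_split_pow_eq_one_of_addCircle hn H z hzc hzn hzz
  refine ⟨b, hb, fun σ h0 => ?_, hbz⟩
  have h := hbN σ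
  rw [h0, zero_pow hN.ne'] at h
  exact zero_ne_one h

end Bridge

/-! ### Specialisation to `Γ_F` and `ℚ̄_ℓ`: part (i) of the named fact, conditionally -/

section NumberField

open Field

/-- **Part (i) of `Patrikis2019_exists_lift_projective`, reduced to Tate's vanishing theorem.**
For a number field `F`, a prime `ℓ` and `n`, *if* every continuous `μ_n(ℚ̄_ℓ)`-valued
`2`-cocycle on `Γ_F` is the coboundary of a continuous `ℚ̄_ℓˣ`-valued cochain (a consequence of
Tate's theorem `H²(Γ_F, ℚ/ℤ) = 0`, Patrikis Thm. 1.0.16 / Serre's Durham survey Thm. 4, which is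
global class field theory and is not available in this tree), then every continuous
`r : Γ_F → PGL_n(ℚ̄_ℓ)` has a continuous lift `W : Γ_F → GL_n(ℚ̄_ℓ)`.  This is exactly the
printed deduction of Prop. 1.0.18 from Thm. 1.0.16.
[cite: Patrikis2019, §2.1 Prop. 1.0.18, proof ("Tate's theorem tells us that lim→ H²(Γ_F, ℤ/n) = H²(Γ_F, ℚ/ℤ) = 0, so for sufficiently large n, there exists a lift")] -/
theorem Patrikis2019_exists_lift_of_twoCocycle (F : Type) [Field F] [NumberField F] (ℓ n : ℕ)
    [Fact ℓ.Prime]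
    (hTate : ∀ z : absoluteGaloisGroup F → absoluteGaloisGroup F → PadicAlgCl ℓ,
      Continuous (Function.uncurry z) → (∀ σ τ, z σ τ ^ n = 1) →
      (∀ σ τ υ, z σ τ * z (σ * τ) υ = z τ υ * z σ (τ * υ)) →
      ∃ b : absoluteGaloisGroup F → PadicAlgCl ℓ, Continuous b ∧ (∀ σ, b σ ≠ 0) ∧
        ∀ σ τ, z σ τ * b (σ * τ) = b σ * b τ)
    (r : absoluteGaloisGroup F →ₜ*
      (GL (Fin n) (PadicAlgCl ℓ) ⧸ Subgroup.center (GL (Fin n) (PadicAlgCl ℓ)))) :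
    ∃ W : FramedGaloisRep F (PadicAlgCl ℓ) n,
      ∀ σ, (QuotientGroup.mk (W σ) : GL (Fin n) (PadicAlgCl ℓ) ⧸ Subgroup.center _) = r σ :=
  exists_continuousMonoidHom_lift_of_twoCocycle hTate r

/-- **Part (i) of `Patrikis2019_exists_lift_projective` from Tate's theorem in `ℚ/ℤ`-cochain
form.**  For a number field `F`, a prime `ℓ` and `n`: *if* `H²(Γ_F, ℚ/ℤ) = 0` in the sense that
every locally constant `2`-cocycle `Γ_F × Γ_F → ℚ/ℤ = AddCircle (1 : ℚ)` (trivial action) is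
the coboundary of a locally constant cochain (Tate's theorem, Patrikis Thm. 1.0.16 = Serre's
Durham survey Thm. 4 — global class field theory, not available in this tree), then every
continuous `r : Γ_F → PGL_n(ℚ̄_ℓ)` lifts to a continuous `W : Γ_F → GL_n(ℚ̄_ℓ)`
(`twoCocycle_split_of_addCircle` + `exists_continuousMonoidHom_lift_of_twoCocycle`).  This is
the printed deduction "Thm. 1.0.16 ⟹ Prop. 1.0.18" for `GL_n ↠ PGL_n`, complete except for
Thm. 1.0.16 itself.
[cite: Patrikis2019, §2.1 Thm. 1.0.16 and Prop. 1.0.18] -/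
theorem Patrikis2019_exists_lift_of_H2_addCircle (F : Type) [Field F] [NumberField F] (ℓ n : ℕ)
    [Fact ℓ.Prime]
    (hTate : ∀ f : absoluteGaloisGroup F → absoluteGaloisGroup F → AddCircle (1 : ℚ),
      IsLocallyConstant (Function.uncurry f) →
      (∀ σ τ υ, f σ τ + f (σ * τ) υ = f τ υ + f σ (τ * υ)) →
      ∃ b : absoluteGaloisGroup F → AddCircle (1 : ℚ), IsLocallyConstant b ∧
        ∀ σ τ, f σ τ + b (σ * τ) = b σ + b τ)
    (r : absoluteGaloisGroup F →ₜ*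
      (GL (Fin n) (PadicAlgCl ℓ) ⧸ Subgroup.center (GL (Fin n) (PadicAlgCl ℓ)))) :
    ∃ W : FramedGaloisRep F (PadicAlgCl ℓ) n,
      ∀ σ, (QuotientGroup.mk (W σ) : GL (Fin n) (PadicAlgCl ℓ) ⧸ Subgroup.center _) = r σ := by
  rcases Nat.eq_zero_or_pos n with hn | hn
  · subst hn
    refine ⟨1, fun σ => ?_⟩
    obtain ⟨g, hg⟩ := QuotientGroup.mk_surjective (r σ)
    rw [← hg, Subsingleton.elim g ((1 : FramedGaloisRep F (PadicAlgCl ℓ) 0) σ)]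
  · exact exists_continuousMonoidHom_lift_of_twoCocycle
      (fun z hzc hzn hzz => twoCocycle_split_of_addCircle hn hTate z hzc hzn hzz) r

/-- **Lifts with finite-order determinant (Patrikis 2019, Remark 1.0.19 (2)) from Tate's
theorem in `ℚ/ℤ`-cochain form.**  For a number field `F`, a prime `ℓ` and `n`: *if*
`H²(Γ_F, ℚ/ℤ) = 0` in locally-constant-cochain form (Tate's theorem, Patrikis Thm. 1.0.16 —
global class field theory, not available in this tree), then every continuous
`r : Γ_F → PGL_n(ℚ̄_ℓ)` has a continuous lift `W : Γ_F → GL_n(ℚ̄_ℓ)` whose determinant has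
finite order: `(det W)^N = 1` for some `N ≥ 1` ("in the case of `GL_n → PGL_n`, this proof
produces lifts with finite-order determinant").
[cite: Patrikis2019, §2.1 Remark 1.0.19 (2)] -/
theorem Patrikis2019_exists_lift_det_pow_eq_one_of_H2_addCircle (F : Type) [Field F]
    [NumberField F] (ℓ n : ℕ) [Fact ℓ.Prime]
    (hTate : ∀ f : absoluteGaloisGroup F → absoluteGaloisGroup F → AddCircle (1 : ℚ),
      IsLocallyConstant (Function.uncurry f) →
      (∀ σ τ υ, f σ τ + f (σ * τ) υ = f τ υ + f σ (τ * υ)) →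
      ∃ b : absoluteGaloisGroup F → AddCircle (1 : ℚ), IsLocallyConstant b ∧
        ∀ σ τ, f σ τ + b (σ * τ) = b σ + b τ)
    (r : absoluteGaloisGroup F →ₜ*
      (GL (Fin n) (PadicAlgCl ℓ) ⧸ Subgroup.center (GL (Fin n) (PadicAlgCl ℓ)))) :
    ∃ (W : FramedGaloisRep F (PadicAlgCl ℓ) n) (N : ℕ), 0 < N ∧
      (∀ σ, (QuotientGroup.mk (W σ) : GL (Fin n) (PadicAlgCl ℓ) ⧸ Subgroup.center _) = r σ) ∧
      ∀ σ, ((W σ : GL (Fin n) (PadicAlgCl ℓ)) : Matrix (Fin n) (Fin n) (PadicAlgCl ℓ)).det ^ N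
        = 1 := by
  rcases Nat.eq_zero_or_pos n with hn | hn
  · subst hn
    refine ⟨1, 1, one_pos, fun σ => ?_, fun σ => ?_⟩
    · obtain ⟨g, hg⟩ := QuotientGroup.mk_surjective (r σ)
      rw [← hg, Subsingleton.elim g ((1 : FramedGaloisRep F (PadicAlgCl ℓ) 0) σ)]
    · rw [Matrix.det_isEmpty, one_pow]
  · exact exists_continuousMonoidHom_lift_det_pow_eq_one_of_twoCocycle
      (fun z hzc hzn hzz => twoCocycle_split_pow_eq_one_of_addCircle hn hTate z hzc hzn hzz) r

end NumberField

end Literature.NumberTheory.GaloisRepresentations
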